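import Summits.QuantumFields.BalabanUV.Beta.AxialDressingRootedBmLegs

/-!
# PREPARATORY (pending β-lead RULING (R42-1); touches NO wall object): the BLOCK-MEAN bond slot `coProjBmAtK`, translation
# sockets, and the jet functor `dressBmAt : JetData d N → JetData d N` (defined BESIDE `dressAt`, replacing nothing)

HONEST FRAMING (cell charter, verbatim): «discharging BetaPertH makes Balaban's UV stability UNCONDITIONAL — a real
constructive-QFT result; it is NOT the continuum limit and NOT the Clay problem.»  DERIVED cell leaf (β sub-cell, lane an2 gen 12,
NOTE X-an2-42 repair (A), file 3); no statement of Bałaban's papers, no `[cite:]` tag, no `Prop` fact; instantiates no wall binder.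
NOT `BetaPertH`; NOT continuum; NOT Clay.

## What is here (decl-by-decl twins of `AxialDressingRootedLegs` §6–§8 with `pm ↦ pmBm`)
* §4 the bond slot `coProjBmAtK ρ N S` (entrywise `Πᵀ_bm`), `locStencil_coProjBmAtK` (constant `cKb'`), `locStencil_dressKBmAt`.
* §5 `dressKBmAt_shiftK`, `coProjBmAtK_shiftK`, and the sockets `dressBmAtS_translate` / `dressBmAtW_translate` (shapes of
  `dressAtS_translate` / `dressAtW_translate` verbatim).
* §6 `dressBmAt (hr : r ∈ box (d+1) N) : JetData d N → JetData d N` (fields `S W Cs Cw δ δ_pos loc loc₂`), `dressBmAt_S/_W/_δ/_Cs/_Cw`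
  (`rfl`), and the centred instance `dressBmCtr` (`r = ctrOff (d+1) N`).
All declarations `[folklore]`; axioms standard.  Provenance: b2b-balaban β sub-cell, unit beta-an2 gen 12, 2026-08-20.
-/

open Finset
open scoped BigOperators
open Literature.MathematicalPhysics.QuantumFieldTheory
open Literature.MathematicalPhysics.QuantumFieldTheory.Balaban1983to89
open Literature.MathematicalPhysics.QuantumFieldTheory.Balaban1983to89.Beta
open B12Sec2to5 (l1 l1_nonneg)
open ExpKernelCalculus (MKer Decays BiLoc comp tr shiftK l1_sub_triangle l1_sub_symm)
open AffineAveraging (Form0 Form1 box toSite unitVec unitVec_apply)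
open AveragingContoursRooted (ctrOff ctrOff_mem_box)
open AxialDressing (exp_recenter_le)
open OneStepResolventKernel (Fib LocStencil JetData)
open Summit.QuantumFields.BalabanUV.Beta.TameKernelCalculus

namespace Summit.QuantumFields.BalabanUV.Beta.AxialDressingRooted

noncomputable section

variable {d : ℕ}

/-! ## §4 The bond slot: `Πᵀ_bm` on the `MKer`-valued stencil family -/

section BondSlot

/-- [folklore] `Πᵀ_bm` on an `MKer`-valued bond family, entrywise: `(Πᵀ_bm S) κ u x y a b := Πᵀ_bm (S · · x y a b) κ u`. -/
def coProjBmAtK (ρ : Fin (d + 1) → ℤ) (N : ℕ)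
    (S : Fin (d + 1) → (Fin (d + 1) → ℤ) → MKer (d + 1) (Fib d)) :
    Fin (d + 1) → (Fin (d + 1) → ℤ) → MKer (d + 1) (Fib d) :=
  fun κ u x y a b => coProjBmAt ρ N (fun κ' u' => S κ' u' x y a b) κ u

/-- [folklore] Evaluation at a kernel entry commutes with `Πᵀ_bm` (by definition). -/
theorem coProjBmAtK_eval (ρ : Fin (d + 1) → ℤ) (N : ℕ)
    (S : Fin (d + 1) → (Fin (d + 1) → ℤ) → MKer (d + 1) (Fib d))
    (κ : Fin (d + 1)) (u x y : Fin (d + 1) → ℤ) (a b : Fib d) :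
    coProjBmAtK ρ N S κ u x y a b = coProjBmAt ρ N (fun κ' u' => S κ' u' x y a b) κ u := rfl

/-- [folklore] The block-mean dressing constant of the bond slot: `cKb' := cWb d N · exp(2δ(d+1)N)`. -/
def cKb' (d N : ℕ) (δ : ℝ) : ℝ := cWb d N * Real.exp (2 * δ * (((d : ℝ) + 1) * N))

/-- [folklore] `0 ≤ cKb'`. -/
theorem cKb'_nonneg (d N : ℕ) (δ : ℝ) : 0 ≤ cKb' d N δ := by
  unfold cKb'
  exact mul_nonneg (cWb_nonneg _ _) (Real.exp_pos _).le

/-- [folklore] **THE BLOCK-MEAN BOND-SLOT DRESSING PRESERVES `LocStencil`:** `LocStencil S Cs δ ⇒ LocStencil (Πᵀ_bm S) (cKb'·Cs) δ`. -/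
theorem locStencil_coProjBmAtK {N : ℕ} (hN : 1 ≤ N) {r : Fin (d + 1) → ℕ} (hr : r ∈ box (d + 1) N)
    {S : Fin (d + 1) → (Fin (d + 1) → ℤ) → MKer (d + 1) (Fib d)} {Cs δ : ℝ}
    (hS : LocStencil S Cs δ) (hδ : 0 ≤ δ) : LocStencil (coProjBmAtK (toSite r) N S) (cKb' d N δ * Cs) δ := by
  have hC : 0 ≤ Cs := (hS 0 0).nonneg (Sum.inl 0)
  intro κ u x y a b
  rw [coProjBmAtK_eval]
  have hM : ∀ (κ' : Fin (d + 1)) (v : Fin (d + 1) → ℤ), v ∈ cube (d + 1) N →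
      |S κ' (u + v) x y a b| ≤ Cs * Real.exp (2 * δ * (((d : ℝ) + 1) * N)) * Real.exp (-δ * (l1 (x - u) + l1 (y - u))) := by
    intro κ' v hv
    have hr' : l1 ((u + v) - u) ≤ ((d : ℝ) + 1) * N := by
      rw [add_sub_cancel_left]
      have h := l1_le_of_mem_cube hv
      push_cast at h
      exact h
    have tx : l1 (x - u) ≤ l1 (x - (u + v)) + l1 ((u + v) - u) := l1_sub_triangle x (u + v) u
    have ty : l1 (y - u) ≤ l1 (y - (u + v)) + l1 ((u + v) - u) := l1_sub_triangle y (u + v) u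
    calc |S κ' (u + v) x y a b| ≤ Cs * Real.exp (-δ * (l1 (x - (u + v)) + l1 (y - (u + v)))) := hS κ' (u + v) x y a b
      _ ≤ Cs * (Real.exp (2 * δ * (((d : ℝ) + 1) * N)) * Real.exp (-δ * (l1 (x - u) + l1 (y - u)))) := by
          refine mul_le_mul_of_nonneg_left ?_ hC
          rw [← Real.exp_add]
          exact Real.exp_le_exp.2 (by nlinarith)
      _ = Cs * Real.exp (2 * δ * (((d : ℝ) + 1) * N)) * Real.exp (-δ * (l1 (x - u) + l1 (y - u))) := by ring
  calc |coProjBmAt (toSite r) N (fun κ' u' => S κ' u' x y a b) κ u|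
      ≤ cWb d N * (Cs * Real.exp (2 * δ * (((d : ℝ) + 1) * N)) * Real.exp (-δ * (l1 (x - u) + l1 (y - u)))) :=
        abs_coProjBmAt_le hN hr _ κ u hM
    _ = cKb' d N δ * Cs * Real.exp (-δ * (l1 (x - u) + l1 (y - u))) := by
        unfold cKb'
        ring

/-- [folklore] `LocStencil` survives the full block-mean kernel dressing of every stencil value as well. -/
theorem locStencil_dressKBmAt {N : ℕ} (hN : 1 ≤ N) {r : Fin (d + 1) → ℕ} (hr : r ∈ box (d + 1) N)
    {S : Fin (d + 1) → (Fin (d + 1) → ℤ) → MKer (d + 1) (Fib d)} {Cs δ : ℝ}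
    (hS : LocStencil S Cs δ) (hδ : 0 ≤ δ) :
    LocStencil (fun κ u => dressKBmAt (toSite r) N (S κ u)) (cKb d N δ * (cKb d N δ * Cs)) δ :=
  fun κ u => biLoc_dressKBmAt hN hr (hS κ u) hδ

end BondSlot

/-! ## §5 Coarse-translation covariance; the `covS` / `covW` sockets -/

section ShiftBm

/-- [folklore] **THE BLOCK-MEAN KERNEL DRESSING COMMUTES WITH COARSE SHIFTS.** -/
theorem dressKBmAt_shiftK (ρ : Fin (d + 1) → ℤ) {N : ℕ} (hN : 1 ≤ N) (K : MKer (d + 1) (Fib d)) (t : Fin (d + 1) → ℤ) :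
    dressKBmAt ρ N (shiftK (-((N : ℤ) • t)) K) = shiftK (-((N : ℤ) • t)) (dressKBmAt ρ N K) := by
  unfold dressKBmAt
  rw [← ExpKernelCalculus.comp_shiftK, ← ExpKernelCalculus.comp_shiftK, ← trK_shiftK, shiftK_piKBm ρ hN]

/-- [folklore] `Πᵀ_bm` on an `MKer`-valued bond family commutes with a simultaneous shift of the kernel arguments. -/
theorem coProjBmAtK_shiftK (ρ : Fin (d + 1) → ℤ) (N : ℕ)
    (S : Fin (d + 1) → (Fin (d + 1) → ℤ) → MKer (d + 1) (Fib d)) (v : Fin (d + 1) → ℤ) (κ : Fin (d + 1))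
    (u : Fin (d + 1) → ℤ) :
    coProjBmAtK ρ N (fun κ' u' => shiftK v (S κ' u')) κ u = shiftK v (coProjBmAtK ρ N S κ u) :=
  rfl

/-- [folklore] **THE `covS` SOCKET SURVIVES THE BLOCK-MEAN DRESSING** (shape of `dressAtS_translate`): if
`S κ (u + N•t) = shiftK (−N•t) (S κ u)` then `dressKBmAt ρ N (Πᵀ_bm S κ u)` obeys the same law. -/
theorem dressBmAtS_translate (ρ : Fin (d + 1) → ℤ) {N : ℕ} (hN : 1 ≤ N)
    {S : Fin (d + 1) → (Fin (d + 1) → ℤ) → MKer (d + 1) (Fib d)}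
    (hS : ∀ κ u t, S κ (u + (N : ℤ) • t) = shiftK (-((N : ℤ) • t)) (S κ u))
    (κ : Fin (d + 1)) (u t : Fin (d + 1) → ℤ) :
    dressKBmAt ρ N (coProjBmAtK ρ N S κ (u + (N : ℤ) • t))
      = shiftK (-((N : ℤ) • t)) (dressKBmAt ρ N (coProjBmAtK ρ N S κ u)) := by
  have h1 : coProjBmAtK ρ N S κ (u + (N : ℤ) • t) = coProjBmAtK ρ N (fun κ' u' => S κ' (u' + (N : ℤ) • t)) κ u := by
    funext x y a b
    exact (coProjBmAt_shift ρ hN (fun κ' u' => S κ' u' x y a b) t κ u).symm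
  have h2 : (fun κ' u' => S κ' (u' + (N : ℤ) • t)) = fun κ' u' => shiftK (-((N : ℤ) • t)) (S κ' u') := by
    funext κ' u'
    exact hS κ' u' t
  rw [h1, h2, coProjBmAtK_shiftK, dressKBmAt_shiftK ρ hN]

/-- [folklore] **THE `covW` SOCKET SURVIVES THE BLOCK-MEAN DRESSING** (shape of `dressAtW_translate`). -/
theorem dressBmAtW_translate (ρ : Fin (d + 1) → ℤ) {N : ℕ} (hN : 1 ≤ N)
    {W : Fin (d + 1) → (Fin (d + 1) → ℤ) → Fin (d + 1) → (Fin (d + 1) → ℤ) → MKer (d + 1) (Fib d)}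
    (hW : ∀ μ y ν y' t, W μ (y + t) ν (y' + t) = shiftK (-((N : ℤ) • t)) (W μ y ν y'))
    (μ : Fin (d + 1)) (y : Fin (d + 1) → ℤ) (ν : Fin (d + 1)) (y' t : Fin (d + 1) → ℤ) :
    dressKBmAt ρ N (W μ (y + t) ν (y' + t)) = shiftK (-((N : ℤ) • t)) (dressKBmAt ρ N (W μ y ν y')) := by
  rw [hW, dressKBmAt_shiftK ρ hN]

end ShiftBm

/-! ## §6 The block-mean dressing functor `dressBmAt` on `JetData` -/

section DressBm

/-- [folklore] **THE BLOCK-MEAN DRESSING FUNCTOR** `dressBmAt`: for an in-block root offset `r ∈ {0,…,N−1}^{d+1}`, `Πᵀ_bm` on the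
stencil bond slot and (comp form) on both `inl`-legs of every stencil value and of every second-order table; same rate, constants
`cKb²·cKb'·Cs` and `cKb²·Cw`.  Decl-by-decl twin of `dressAt` with the block-mean-normalised projector (NOTE X-an2-42 repair (A)). -/
def dressBmAt {N : ℕ} [NeZero N] {r : Fin (d + 1) → ℕ} (hr : r ∈ box (d + 1) N) (J : JetData d N) : JetData d N where
  S := fun κ u => dressKBmAt (toSite r) N (coProjBmAtK (toSite r) N J.S κ u)
  W := fun μ y ν y' => dressKBmAt (toSite r) N (J.W μ y ν y')
  Cs := cKb d N J.δ * (cKb d N J.δ * (cKb' d N J.δ * J.Cs))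
  Cw := cKb d N J.δ * (cKb d N J.δ * J.Cw)
  δ := J.δ
  δ_pos := J.δ_pos
  loc := locStencil_dressKBmAt (one_le_of_neZero N) hr
    (locStencil_coProjBmAtK (one_le_of_neZero N) hr J.loc J.δ_pos.le) J.δ_pos.le
  loc₂ := fun μ y ν y' => biLoc_dressKBmAt (one_le_of_neZero N) hr (J.loc₂ μ y ν y') J.δ_pos.le

/-- [folklore] The block-mean-dressed stencil family, by definition. -/
theorem dressBmAt_S {N : ℕ} [NeZero N] {r : Fin (d + 1) → ℕ} (hr : r ∈ box (d + 1) N) (J : JetData d N)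
    (κ : Fin (d + 1)) (u : Fin (d + 1) → ℤ) :
    (dressBmAt hr J).S κ u = dressKBmAt (toSite r) N (coProjBmAtK (toSite r) N J.S κ u) := rfl

/-- [folklore] The block-mean-dressed second-order family, by definition. -/
theorem dressBmAt_W {N : ℕ} [NeZero N] {r : Fin (d + 1) → ℕ} (hr : r ∈ box (d + 1) N) (J : JetData d N)
    (μ : Fin (d + 1)) (y : Fin (d + 1) → ℤ) (ν : Fin (d + 1)) (y' : Fin (d + 1) → ℤ) :
    (dressBmAt hr J).W μ y ν y' = dressKBmAt (toSite r) N (J.W μ y ν y') := rfl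

/-- [folklore] The block-mean dressing keeps the localisation rate. -/
theorem dressBmAt_δ {N : ℕ} [NeZero N] {r : Fin (d + 1) → ℕ} (hr : r ∈ box (d + 1) N) (J : JetData d N) :
    (dressBmAt hr J).δ = J.δ := rfl

/-- [folklore] The constants of the block-mean dressing, by definition. -/
theorem dressBmAt_Cs {N : ℕ} [NeZero N] {r : Fin (d + 1) → ℕ} (hr : r ∈ box (d + 1) N) (J : JetData d N) :
    (dressBmAt hr J).Cs = cKb d N J.δ * (cKb d N J.δ * (cKb' d N J.δ * J.Cs)) := rfl

/-- [folklore] The constants of the block-mean dressing, by definition. -/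
theorem dressBmAt_Cw {N : ℕ} [NeZero N] {r : Fin (d + 1) → ℕ} (hr : r ∈ box (d + 1) N) (J : JetData d N) :
    (dressBmAt hr J).Cw = cKb d N J.δ * (cKb d N J.δ * J.Cw) := rfl

/-- [folklore] **THE CENTRED BLOCK-MEAN DRESSING** (Bałaban's root: the block centre, `N` odd downstream). -/
def dressBmCtr {N : ℕ} [NeZero N] (J : JetData d N) : JetData d N :=
  dressBmAt (ctrOff_mem_box (d := d + 1) (one_le_of_neZero N)) J

/-- [folklore] `dressBmCtr` unfolds to `dressBmAt` at the centre offset. -/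
theorem dressBmCtr_eq {N : ℕ} [NeZero N] (J : JetData d N) :
    dressBmCtr J = dressBmAt (ctrOff_mem_box (d := d + 1) (one_le_of_neZero N)) J := rfl

end DressBm

end

end Summit.QuantumFields.BalabanUV.Beta.AxialDressingRooted
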